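import Summits.Ventures.GridStability.Lyapunov.PolyRecast
import HarnessLib

/-!
# GridStability/Lyapunov/PolyRecastBox — a `decide`-able BOX MAJORANT of an emitted `Poly`: `|p(x)| ≤ Σ |c_m|·Π B_i^{e_i}` when `|x_i| ≤ B_i`

Cell `gridfusion` (LADDER-GRIDFUSION), `plan/PARTITION.md` §0 row `Lyapunov/` (generic glue in the namespace
`Summit.Ventures.GridStability.Lyapunov.PolyRecast` of lyap-1's `PolyRecast.lean` / sos-3's `PolyRecastEval.lean`);
seat gridfusion-lyap-2 (g3), for the REGION-SIZE riders («… BALL») of certificates whose Lyapunov function is too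
large for a Gram-matrix bound in the seat (#50: quartic own-V, 534 monomials). PURPOSE: an INNER BALL of a
certified sublevel piece `{V ≤ c} ∩ {h = 0}` needs an UPPER bound of `V` near the equilibrium; the crude but
exact coefficient majorant `V(x) ≤ Σ_m |c_m| Π_i B_i^{e_i}` on the box `|x_i| ≤ B_i` is a rational number the
kernel computes from the literal (`absBox`), so «box ⊆ piece» is ONE `decide` on `absBox B V_poly ≤ c` plus the
elementary box facts (`σ² ≤ φ`, `0 ≤ κ ≤ φ/2` on `{h = 0}`, `ν²/4 ≤ φ`).

* `boxFrom B k m = Π_i B (k + i) ^ mᵢ` and `absBox B p = Σ_{(m, c) ∈ p} |c| · boxFrom B 0 m` (computable, over `ℚ`);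
* `abs_evalFrom_le_boxFrom`, `abs_eval_le_absBox`, `eval_le_absBox` — the majorant property for any
  `x : ℕ → ℝ` with `|x i| ≤ B i` for all `i`.

Pure bookkeeping (MODELLED/CERTIFIED columns untouched): standard axioms, no named fact; the two `def`s are
computation-oriented (data refinement of "sum of absolute values of the terms"). [folklore]
-/

noncomputable section

open Literature.Computation.Certificates Literature.Computation.Certificates.SOS

namespace Summit.Ventures.GridStability.Lyapunov.PolyRecast

/-- Box majorant of a monomial read from variable index `k`: `boxFrom B k [e₀, e₁, …] = B k ^ e₀ · B (k+1) ^ e₁ ⋯`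
(the twin of `SOS.Monomial.evalFrom` with `B` in place of `x`). [folklore] -/
def boxFrom (B : ℕ → ℚ) : ℕ → Monomial → ℚ
  | _, [] => 1
  | k, e :: es => B k ^ e * boxFrom B (k + 1) es

/-- Coefficient box majorant of a sparse polynomial: `absBox B p = Σ |c| · boxFrom B 0 m` over the terms `(m, c)`
of `p` (term order and duplicates immaterial). [folklore] -/
def absBox (B : ℕ → ℚ) : Poly → ℚ
  | [] => 0
  | (m, c) :: p => |c| * boxFrom B 0 m + absBox B p

/-- `boxFrom` is nonnegative when the bounds are. [folklore] -/
theorem boxFrom_nonneg {B : ℕ → ℚ} (hB : ∀ i, 0 ≤ B i) : ∀ (m : Monomial) (k : ℕ), 0 ≤ boxFrom B k m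
  | [], k => by simp [boxFrom]
  | e :: es, k => by
      simp only [boxFrom]
      exact mul_nonneg (pow_nonneg (hB k) e) (boxFrom_nonneg hB es (k + 1))

/-- **Monomial majorant**: `|x_k^{e₀} x_{k+1}^{e₁} ⋯| ≤ boxFrom B k m` when `|x i| ≤ B i` for every `i`. [folklore] -/
theorem abs_evalFrom_le_boxFrom {x : ℕ → ℝ} {B : ℕ → ℚ} (hB : ∀ i, |x i| ≤ (B i : ℝ)) :
    ∀ (m : Monomial) (k : ℕ), |Monomial.evalFrom x k m| ≤ ((boxFrom B k m : ℚ) : ℝ)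
  | [], k => by simp [boxFrom]
  | e :: es, k => by
      simp only [Monomial.evalFrom_cons, boxFrom]
      push_cast
      rw [abs_mul, abs_pow]
      have h0 : (0 : ℝ) ≤ (B k : ℝ) := (abs_nonneg _).trans (hB k)
      exact mul_le_mul (pow_le_pow_left₀ (abs_nonneg _) (hB k) e) (abs_evalFrom_le_boxFrom hB es (k + 1))
        (abs_nonneg _) (pow_nonneg h0 e)

/-- **Polynomial majorant**: `|p(x)| ≤ absBox B p` when `|x i| ≤ B i` for every `i`. [folklore] -/
theorem abs_eval_le_absBox {x : ℕ → ℝ} {B : ℕ → ℚ} (hB : ∀ i, |x i| ≤ (B i : ℝ)) :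
    ∀ p : Poly, |Poly.eval x p| ≤ ((absBox B p : ℚ) : ℝ)
  | [] => by simp [absBox]
  | (m, c) :: p => by
      simp only [Poly.eval_cons, absBox, Monomial.eval_eq]
      push_cast
      refine (abs_add_le _ _).trans (add_le_add ?_ (abs_eval_le_absBox hB p))
      rw [abs_mul]
      exact mul_le_mul_of_nonneg_left (abs_evalFrom_le_boxFrom hB m 0) (abs_nonneg _)

/-- **Upper bound form** (the one a «BALL» rider decides): `p(x) ≤ absBox B p` when `|x i| ≤ B i` for every `i`.
[folklore] -/
theorem eval_le_absBox {x : ℕ → ℝ} {B : ℕ → ℚ} (hB : ∀ i, |x i| ≤ (B i : ℝ)) (p : Poly) :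
    Poly.eval x p ≤ ((absBox B p : ℚ) : ℝ) :=
  (le_abs_self _).trans (abs_eval_le_absBox hB p)

/-- Test (kernel): for `p = 3x₀²x₁ − x₁³` and the box `B = (1/2, 2)`: `absBox = 3·(1/4)·2 + 8 = 19/2`. -/
example : absBox (vars [(1 : ℚ) / 2, 2]) [(([2, 1] : List ℕ), (3 : ℚ)), (([0, 3] : List ℕ), (-1 : ℚ))] = 19 / 2 := by
  decide +kernel

end Summit.Ventures.GridStability.Lyapunov.PolyRecast

end
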